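import Summits.BirchSwinnertonDyer.BirchSwinnertonDyer.Theorems.Rank2ObservatoryCosetWitness3
import Summits.BirchSwinnertonDyer.BirchSwinnertonDyer.Theorems.Rank2ObservatorySaturationSieve
import HarnessLib

/-!
# BirchSwinnertonDyer — rank ≥ 2 observatory: the listed span of three points is `2`-saturated

HONEST FRAMING: per-curve certified theorems and census instruments; no claim on BSD in rank ≥ 2.

The rank-3 kernel certificates (`Rank2ObservatoryRank3Witness.lean`, machine-written
`Rank2ObservatoryRank3KernelCerts*`) prove `3 ≤ rank_ℤ E(ℚ)` for every row of the rank-3 table from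
a torsion annihilator `2^u · m` (`m` odd) and SEVEN coset witnesses: each non-trivial
`𝔽₂`-combination `ε₁P₁ + ε₂P₂ + ε₃P₃` of the listed generators lies outside
`twoCoset E(ℚ) u = 2E(ℚ) + E(ℚ)[2^u]` (`Rank2ObservatoryCosetWitness3.lean`). This file records,
once and in the abstract (an arbitrary additive commutative group `A`; nothing below mentions
elliptic curves), that the SAME data prove more than independence — the regulator-side statement
that the listed generators are `2`-SATURATED. The LISTED SPAN is the subgroup
`AddSubgroup.closure {P₁, P₂, P₃} ⊔ AddCommGroup.torsion A = ℤP₁ + ℤP₂ + ℤP₃ + A_tors`, spelled out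
in every statement (no auxiliary definition):

* `mem_listedSpan_iff` — `x` lies in the listed span iff a translate `x − (aP₁ + bP₂ + cP₃)` has
  finite order (`mem_closure_triple_iff`: the closure of three points is their `ℤ`-combinations);
* `listedSpan_two_saturated_of_not_mem_twoCoset` — under the annihilator hypothesis the seven
  witnesses give `∀ x, 2 • x ∈ span → x ∈ span` (Cremona 1997 §3.5: points independent in
  `E(ℚ)/2E(ℚ)` modulo torsion). Proof: if `2x = aP₁ + bP₂ + cP₃ + t`, `t` of finite order, with a
  coefficient odd, then `aP₁ + bP₂ + cP₃ = 2x − t ∈ 2A + A[2^u]` (`t` is killed by `2^u m`, so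
  `t ∈ twoCoset` by `mem_twoCoset_of_zsmul_eq_zero`) — excluded by the parity lemma
  `not_mem_twoCoset_of_parity`; if all are even, `x − (a/2)P₁ − (b/2)P₂ − (c/2)P₃` has finite order;
* `finiteIndex_listedSpan` — if `A` is finitely generated with `Module.finrank ℤ A = 3` and
  `P₁, P₂, P₃` are `ℤ`-independent, the listed span has finite index (a fourth point is dependent
  on three independent ones in rank `3`, so the quotient is a finitely generated torsion group);
* `not_two_dvd_index_listedSpan` / `odd_index_listedSpan` / `finiteIndex_and_odd_index_listedSpan`
  — then the index is ODD (`SaturationSieve.not_dvd_index_of_isSaturatedAt`, Cauchy in the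
  quotient): the regulator of the listed points is an odd square times the regulator of `A/A_tors`;
* transport along an isomorphism `e : A ≃+ B` (`mem_listedSpan_map_iff`, `two_saturated_map`,
  `linearIndependent_triple_map`) — to move a certificate from a scaled integral model to the
  census equation.

Sorry-free; axioms `propext`, `Classical.choice`, `Quot.sound` only.

References: J. E. Cremona, *Algorithms for Modular Elliptic Curves* (2nd ed. 1997), §3.5
(saturation at `2` from independence modulo `2E(ℚ)` and torsion); S. Siksek, *Infinite descent on
elliptic curves*, Rocky Mountain J. Math. 25 (1995) 1501–1538 (saturation and index bounds);
J. H. Silverman, *The Arithmetic of Elliptic Curves* (2nd ed. 2009), Thm. VIII.6.7 (Mordell–Weil).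
-/

-- single-conjunct summit: `Summit.BirchSwinnertonDyer.BirchSwinnertonDyer.…` repeats the name
set_option linter.dupNamespace false

namespace Summit.BirchSwinnertonDyer.BirchSwinnertonDyer.Rank2Observatory

section Algebra

variable {A : Type*} [AddCommGroup A] {P₁ P₂ P₃ : A}

/-! ### The listed span `ℤP₁ + ℤP₂ + ℤP₃ + A_tors` -/

/-- Elements of the subgroup generated by three points are their `ℤ`-combinations. [folklore] -/
theorem mem_closure_triple_iff {x : A} :
    x ∈ AddSubgroup.closure ({P₁, P₂, P₃} : Set A) ↔
      ∃ a b c : ℤ, a • P₁ + b • P₂ + c • P₃ = x := by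
  constructor
  · intro hx
    induction hx using AddSubgroup.closure_induction with
    | mem y hy =>
      simp only [Set.mem_insert_iff, Set.mem_singleton_iff] at hy
      rcases hy with rfl | rfl | rfl
      · exact ⟨1, 0, 0, by rw [one_smul, zero_smul, zero_smul, add_zero, add_zero]⟩
      · exact ⟨0, 1, 0, by rw [one_smul, zero_smul, zero_smul, zero_add, add_zero]⟩
      · exact ⟨0, 0, 1, by rw [one_smul, zero_smul, zero_smul, zero_add, zero_add]⟩
    | zero => exact ⟨0, 0, 0, by rw [zero_smul, zero_smul, zero_smul, add_zero, add_zero]⟩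
    | add y z _ _ hy hz =>
      obtain ⟨a, b, c, rfl⟩ := hy
      obtain ⟨a', b', c', rfl⟩ := hz
      exact ⟨a + a', b + b', c + c', by module⟩
    | neg y _ hy =>
      obtain ⟨a, b, c, rfl⟩ := hy
      exact ⟨-a, -b, -c, by module⟩
  · rintro ⟨a, b, c, rfl⟩
    have h₁ : P₁ ∈ AddSubgroup.closure ({P₁, P₂, P₃} : Set A) :=
      AddSubgroup.subset_closure (by simp)
    have h₂ : P₂ ∈ AddSubgroup.closure ({P₁, P₂, P₃} : Set A) :=
      AddSubgroup.subset_closure (by simp)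
    have h₃ : P₃ ∈ AddSubgroup.closure ({P₁, P₂, P₃} : Set A) :=
      AddSubgroup.subset_closure (by simp)
    exact add_mem (add_mem (AddSubgroup.zsmul_mem _ h₁ a) (AddSubgroup.zsmul_mem _ h₂ b))
      (AddSubgroup.zsmul_mem _ h₃ c)

/-- **Membership in the LISTED SPAN** `ℤP₁ + ℤP₂ + ℤP₃ + A_tors` (the subgroup generated by the
three points and the torsion subgroup): `x` belongs to it iff some translate
`x − (aP₁ + bP₂ + cP₃)` has finite order. [cite: CremonaAlgorithms1997, §3.5] -/
theorem mem_listedSpan_iff {x : A} :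
    x ∈ AddSubgroup.closure {P₁, P₂, P₃} ⊔ AddCommGroup.torsion A ↔
      ∃ a b c : ℤ, IsOfFinAddOrder (x - (a • P₁ + b • P₂ + c • P₃)) := by
  rw [AddSubgroup.mem_sup]
  constructor
  · rintro ⟨y, hy, z, hz, rfl⟩
    obtain ⟨a, b, c, rfl⟩ := mem_closure_triple_iff.mp hy
    refine ⟨a, b, c, ?_⟩
    rw [add_sub_cancel_left]
    exact (AddCommGroup.mem_torsion z).mp hz
  · rintro ⟨a, b, c, h⟩
    exact ⟨a • P₁ + b • P₂ + c • P₃, mem_closure_triple_iff.mpr ⟨a, b, c, rfl⟩,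
      x - (a • P₁ + b • P₂ + c • P₃), (AddCommGroup.mem_torsion _).mpr h, by abel⟩

/-- Every element of finite order lies in the listed span. [folklore] -/
theorem mem_listedSpan_of_isOfFinAddOrder {x : A} (hx : IsOfFinAddOrder x) :
    x ∈ AddSubgroup.closure {P₁, P₂, P₃} ⊔ AddCommGroup.torsion A :=
  AddSubgroup.mem_sup_right ((AddCommGroup.mem_torsion x).mpr hx)

/-- Every `ℤ`-combination of the three points lies in the listed span. [folklore] -/
theorem combination_mem_listedSpan (a b c : ℤ) :
    a • P₁ + b • P₂ + c • P₃ ∈ AddSubgroup.closure {P₁, P₂, P₃} ⊔ AddCommGroup.torsion A :=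
  AddSubgroup.mem_sup_left (mem_closure_triple_iff.mpr ⟨a, b, c, rfl⟩)

/-! ### The seven coset witnesses give `2`-saturation -/

/-- **Coset witnesses ⇒ the listed span is `2`-saturated.** Let every element of finite order of
`A` be killed by `2^u * m` with `m` odd, and let the seven combinations `ε₁P₁ + ε₂P₂ + ε₃P₃`,
`ε ∈ {0,1}³ ∖ {0}`, lie outside `2•A + A[2^u]`. If `2 • x` lies in the listed span then so does
`x`: writing `2x − (aP₁ + bP₂ + cP₃) = t` of finite order, a coefficient odd would put
`aP₁ + bP₂ + cP₃ = 2x − t` in `2•A + A[2^u]` (`t ∈ twoCoset` by `mem_twoCoset_of_zsmul_eq_zero`),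
against `not_mem_twoCoset_of_parity`; so `a, b, c` are even and
`x − ((a/2)P₁ + (b/2)P₂ + (c/2)P₃)` has finite order (its double is `t`). This is saturation at
`p = 2` in the sense of `Rank2ObservatorySaturationSieve.lean`.
[cite: CremonaAlgorithms1997, §3.5] -/
theorem listedSpan_two_saturated_of_not_mem_twoCoset {u : ℕ} {m : ℤ} (hm : Odd m)
    (htors : ∀ x : A, IsOfFinAddOrder x → ((2 : ℤ) ^ u * m) • x = 0)
    (h₁ : P₁ ∉ twoCoset A u) (h₂ : P₂ ∉ twoCoset A u) (h₃ : P₃ ∉ twoCoset A u)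
    (h₁₂ : P₁ + P₂ ∉ twoCoset A u) (h₁₃ : P₁ + P₃ ∉ twoCoset A u)
    (h₂₃ : P₂ + P₃ ∉ twoCoset A u) (h₁₂₃ : P₁ + P₂ + P₃ ∉ twoCoset A u) :
    ∀ x : A, 2 • x ∈ AddSubgroup.closure {P₁, P₂, P₃} ⊔ AddCommGroup.torsion A →
      x ∈ AddSubgroup.closure {P₁, P₂, P₃} ⊔ AddCommGroup.torsion A := by
  intro x hx
  obtain ⟨a, b, c, habc⟩ := mem_listedSpan_iff.mp hx
  by_cases hev : 2 ∣ a ∧ 2 ∣ b ∧ 2 ∣ c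
  · obtain ⟨⟨a', rfl⟩, ⟨b', rfl⟩, ⟨c', rfl⟩⟩ := hev
    refine mem_listedSpan_iff.mpr ⟨a', b', c', ?_⟩
    have e : 2 • x - ((2 * a') • P₁ + (2 * b') • P₂ + (2 * c') • P₃) =
        (2 : ℕ) • (x - (a' • P₁ + b' • P₂ + c' • P₃)) := by
      module
    rw [e] at habc
    exact habc.of_nsmul two_ne_zero
  · exfalso
    have ht : 2 • x - (a • P₁ + b • P₂ + c • P₃) ∈ twoCoset A u :=
      mem_twoCoset_of_zsmul_eq_zero hm (htors _ habc)
    have e : a • P₁ + b • P₂ + c • P₃ =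
        (2 : ℤ) • x - (2 • x - (a • P₁ + b • P₂ + c • P₃)) := by
      module
    refine not_mem_twoCoset_of_parity h₁ h₂ h₃ h₁₂ h₁₃ h₂₃ h₁₂₃ hev ?_
    rw [e]
    exact sub_mem (two_zsmul_mem_twoCoset u x) ht

/-! ### Finite, odd index in rank three -/

/-- **In rank `3` the listed span of three independent points has finite index.** If `A` is a
finitely generated `ℤ`-module with `Module.finrank ℤ A = 3` (for `A = E(ℚ)`: Mordell–Weil and
`rank_ℤ E(ℚ) = 3`) and `P₁, P₂, P₃` are `ℤ`-linearly independent, then every `x ∈ A` has a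
non-zero multiple in `ℤP₁ + ℤP₂ + ℤP₃` (four elements are dependent,
`LinearIndependent.fintype_card_le_finrank`), so the quotient by the listed span is a finitely
generated torsion group, hence finite (`AddCommGroup.finite_of_fg_torsion`).
[cite: SilvermanAEC2009, Thm. VIII.6.7] -/
theorem finiteIndex_listedSpan [Module.Finite ℤ A] (hr : Module.finrank ℤ A = 3)
    (hind : LinearIndependent ℤ ![P₁, P₂, P₃]) :
    (AddSubgroup.closure {P₁, P₂, P₃} ⊔ AddCommGroup.torsion A).FiniteIndex := by
  -- every element has a non-zero multiple in the listed span
  have hmul : ∀ x : A, ∃ n : ℤ, n ≠ 0 ∧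
      n • x ∈ AddSubgroup.closure {P₁, P₂, P₃} ⊔ AddCommGroup.torsion A := by
    intro x
    have hdep : ¬ LinearIndependent ℤ ![P₁, P₂, P₃, x] := by
      intro h
      have h4 := h.fintype_card_le_finrank
      rw [Fintype.card_fin, hr] at h4
      omega
    obtain ⟨g, hg, i, hi⟩ := Fintype.not_linearIndependent_iff.mp hdep
    simp only [Fin.sum_univ_four, Matrix.cons_val_zero, Matrix.cons_val_one, Matrix.cons_val_two,
      Matrix.cons_val_three, Matrix.head_cons, Matrix.tail_cons] at hg
    by_cases h3 : g 3 = 0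
    · -- then `P₁, P₂, P₃` would be dependent
      exfalso
      have hg' : ∑ j : Fin 3, (fun j : Fin 3 => g (Fin.castSucc j)) j • ![P₁, P₂, P₃] j = 0 := by
        simp only [Fin.sum_univ_three, Matrix.cons_val_zero, Matrix.cons_val_one,
          Matrix.cons_val_two, Matrix.head_cons, Matrix.tail_cons, Fin.castSucc_zero,
          Fin.castSucc_one]
        have e2 : (Fin.castSucc (2 : Fin 3) : Fin 4) = 2 := rfl
        rw [e2, ← hg, h3, zero_smul, add_zero]
      have hz := Fintype.linearIndependent_iff.mp hind _ hg'
      have h0 : g 0 = 0 := hz 0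
      have h1 : g 1 = 0 := hz 1
      have h2 : g 2 = 0 := hz 2
      fin_cases i
      · exact hi h0
      · exact hi h1
      · exact hi h2
      · exact hi h3
    · refine ⟨g 3, h3, mem_listedSpan_iff.mpr ⟨-g 0, -g 1, -g 2, ?_⟩⟩
      have e : g 3 • x - ((-g 0) • P₁ + (-g 1) • P₂ + (-g 2) • P₃) =
          g 0 • P₁ + g 1 • P₂ + g 2 • P₃ + g 3 • x := by
        module
      rw [e, hg]
      exact IsOfFinAddOrder.zero
  -- the quotient is a finitely generated torsion group, hence finite
  haveI : AddGroup.FG A := Module.Finite.iff_addGroup_fg.mp inferInstance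
  have htor :
      AddMonoid.IsTorsion (A ⧸ (AddSubgroup.closure {P₁, P₂, P₃} ⊔ AddCommGroup.torsion A)) := by
    intro q
    obtain ⟨x, rfl⟩ := QuotientAddGroup.mk_surjective q
    obtain ⟨n, hn, hnx⟩ := hmul x
    refine isOfFinAddOrder_iff_zsmul_eq_zero.mpr ⟨n, hn, ?_⟩
    rw [← QuotientAddGroup.mk_zsmul, QuotientAddGroup.eq_zero_iff]
    exact hnx
  haveI : Finite (A ⧸ (AddSubgroup.closure {P₁, P₂, P₃} ⊔ AddCommGroup.torsion A)) :=
    AddCommGroup.finite_of_fg_torsion _ htor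
  exact AddSubgroup.finiteIndex_of_finite_quotient

/-- **Odd index**: a `2`-saturated listed span of finite index has index prime to `2`
(`SaturationSieve.not_dvd_index_of_isSaturatedAt`). [cite: CremonaAlgorithms1997, §3.5] -/
theorem not_two_dvd_index_listedSpan
    [(AddSubgroup.closure {P₁, P₂, P₃} ⊔ AddCommGroup.torsion A).FiniteIndex]
    (hsat : ∀ x : A, 2 • x ∈ AddSubgroup.closure {P₁, P₂, P₃} ⊔ AddCommGroup.torsion A →
      x ∈ AddSubgroup.closure {P₁, P₂, P₃} ⊔ AddCommGroup.torsion A) :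
    ¬ 2 ∣ (AddSubgroup.closure {P₁, P₂, P₃} ⊔ AddCommGroup.torsion A).index :=
  SaturationSieve.not_dvd_index_of_isSaturatedAt _ Nat.prime_two hsat

/-- **Odd index**, `Odd` form. [cite: CremonaAlgorithms1997, §3.5] -/
theorem odd_index_listedSpan
    [(AddSubgroup.closure {P₁, P₂, P₃} ⊔ AddCommGroup.torsion A).FiniteIndex]
    (hsat : ∀ x : A, 2 • x ∈ AddSubgroup.closure {P₁, P₂, P₃} ⊔ AddCommGroup.torsion A →
      x ∈ AddSubgroup.closure {P₁, P₂, P₃} ⊔ AddCommGroup.torsion A) :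
    Odd (AddSubgroup.closure {P₁, P₂, P₃} ⊔ AddCommGroup.torsion A).index :=
  Nat.odd_iff.mpr (Nat.two_dvd_ne_zero.mp (not_two_dvd_index_listedSpan hsat))

/-- **Summary in rank three**: annihilator + seven witnesses + `finrank = 3` give a listed span of
finite ODD index (`ℤ`-independence from `linearIndependent_triple_of_not_mem_twoCoset`,
finiteness from `finiteIndex_listedSpan`, oddness from `2`-saturation): the regulator of
`P₁, P₂, P₃` is an odd square times the regulator of `A / A_tors`.
[cite: CremonaAlgorithms1997, §3.5] -/
theorem finiteIndex_and_odd_index_listedSpan [Module.Finite ℤ A] (hr : Module.finrank ℤ A = 3)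
    {u : ℕ} {m : ℤ} (hm : Odd m)
    (htors : ∀ x : A, IsOfFinAddOrder x → ((2 : ℤ) ^ u * m) • x = 0)
    (h₁ : P₁ ∉ twoCoset A u) (h₂ : P₂ ∉ twoCoset A u) (h₃ : P₃ ∉ twoCoset A u)
    (h₁₂ : P₁ + P₂ ∉ twoCoset A u) (h₁₃ : P₁ + P₃ ∉ twoCoset A u)
    (h₂₃ : P₂ + P₃ ∉ twoCoset A u) (h₁₂₃ : P₁ + P₂ + P₃ ∉ twoCoset A u) :
    (AddSubgroup.closure {P₁, P₂, P₃} ⊔ AddCommGroup.torsion A).FiniteIndex ∧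
      Odd (AddSubgroup.closure {P₁, P₂, P₃} ⊔ AddCommGroup.torsion A).index := by
  haveI := finiteIndex_listedSpan hr
    (linearIndependent_triple_of_not_mem_twoCoset hm htors h₁ h₂ h₃ h₁₂ h₁₃ h₂₃ h₁₂₃)
  exact ⟨this, odd_index_listedSpan
    (listedSpan_two_saturated_of_not_mem_twoCoset hm htors h₁ h₂ h₃ h₁₂ h₁₃ h₂₃ h₁₂₃)⟩

/-! ### Transport along an isomorphism -/

variable {B : Type*} [AddCommGroup B]

/-- The listed span is transported by an isomorphism `e : A ≃+ B`: `y` lies in the span of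
`eP₁, eP₂, eP₃` and the torsion of `B` iff `e⁻¹ y` lies in the span of `P₁, P₂, P₃` and the torsion
of `A`. [folklore] -/
theorem mem_listedSpan_map_iff (e : A ≃+ B) {y : B} :
    y ∈ AddSubgroup.closure {e P₁, e P₂, e P₃} ⊔ AddCommGroup.torsion B ↔
      e.symm y ∈ AddSubgroup.closure {P₁, P₂, P₃} ⊔ AddCommGroup.torsion A := by
  rw [mem_listedSpan_iff, mem_listedSpan_iff]
  have key : ∀ a b c : ℤ, e.symm (y - (a • e P₁ + b • e P₂ + c • e P₃)) =
      e.symm y - (a • P₁ + b • P₂ + c • P₃) := by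
    intro a b c
    rw [map_sub, map_add, map_add, map_zsmul, map_zsmul, map_zsmul, e.symm_apply_apply,
      e.symm_apply_apply, e.symm_apply_apply]
  constructor
  · rintro ⟨a, b, c, h⟩
    refine ⟨a, b, c, ?_⟩
    rw [← key]
    exact e.symm.toAddMonoidHom.isOfFinAddOrder h
  · rintro ⟨a, b, c, h⟩
    refine ⟨a, b, c, ?_⟩
    rw [← key] at h
    exact (e.symm.injective.isOfFinAddOrder_iff (f := e.symm.toAddMonoidHom)).mp h

/-- `2`-saturation of the listed span is transported by an isomorphism. [folklore] -/
theorem two_saturated_map (e : A ≃+ B)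
    (hsat : ∀ x : A, 2 • x ∈ AddSubgroup.closure {P₁, P₂, P₃} ⊔ AddCommGroup.torsion A →
      x ∈ AddSubgroup.closure {P₁, P₂, P₃} ⊔ AddCommGroup.torsion A) :
    ∀ y : B, 2 • y ∈ AddSubgroup.closure {e P₁, e P₂, e P₃} ⊔ AddCommGroup.torsion B →
      y ∈ AddSubgroup.closure {e P₁, e P₂, e P₃} ⊔ AddCommGroup.torsion B := by
  intro y hy
  rw [mem_listedSpan_map_iff] at hy ⊢
  rw [map_nsmul] at hy
  exact hsat _ hy

/-- `ℤ`-independence of a triple is transported by an isomorphism. [folklore] -/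
theorem linearIndependent_triple_map (e : A ≃+ B) (hind : LinearIndependent ℤ ![P₁, P₂, P₃]) :
    LinearIndependent ℤ ![e P₁, e P₂, e P₃] := by
  have hcomp : ![e P₁, e P₂, e P₃] = e.toAddMonoidHom.toIntLinearMap ∘ ![P₁, P₂, P₃] := by
    ext i
    fin_cases i <;> rfl
  rw [hcomp]
  exact hind.map' _ (LinearMap.ker_eq_bot.mpr fun x y h => e.injective h)

end Algebra

end Summit.BirchSwinnertonDyer.BirchSwinnertonDyer.Rank2Observatory
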